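import Summits.HubbardSuperconductivity.HubbardSuperconductivity.Theorems.BalabanIRBirBdGPhaseCoercivityLyapunov
import Summits.HubbardSuperconductivity.HubbardSuperconductivity.Theorems.BalabanIRBirBdGPhaseCoercivityLyapunovHat
import Summits.HubbardSuperconductivity.HubbardSuperconductivity.Theorems.BalabanIRBirBdGPhaseCoercivityModes

/-!
# Route BalabanIR — crux 3 `BirBdGPhaseCoercivity` (item `stmt-HubbardSuperconductivity-2081`):
# the Lyapunov deficit bound on the torus — the commutator form

THEOREM (`lyap_core`). Fix `μ, Δ₁, Δ₂`, `L ≥ 3`, the symbols `ξ_k, Δ_k, E_k = √(ξ_k² + |Δ_k|²)` of the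
crux's hopping and `d+id` pairing stencils (`p = 2πk/L`), and a uniform lower bound
`0 < m ≤ E_k`. Then for every phase texture `θ` (with `u = e^{iθ}`, `F = N⁻¹ Wᴴ diag(Δ/E) W` the
position-space anomalous amplitude of the reference BdG ground state, `N = L²`, `W` the plane
waves):
  `(m/4) Σ_{x,y} |F_{xy}|² |u_y - u_x|² ≤ Σ_i |λ_i(Hb(0))| - Σ_i |λ_i(Hb(θ))|`.
PROOF. The abstract deficit bound `lyap_deficit` (file `…Lyapunov`) in position space with
`E_pos = N⁻¹ Wᴴ diag(E) W` (all commutation hypotheses are identities of diagonal matrices after the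
plane-wave conjugation of files `…Fourier`/`…Symbols`) and the optimal `Φ = Σ |D^|²/(E + E')`
(`lyap_admissible`, file `…LyapunovHat`) gives `S(0) - S(θ) ≥ Σ_k |Δ_k|²/E_k - 2Φ`. With
`D^_{kk'} = ½ Û_{kk'} (Δ_k + Δ_{k'})` (`hat_pairing_apply`) and the unit row/column sums of the
unitary `Û = (diag u)^`, the right-hand side is the manifestly nonnegative Bergström sum
`½ Σ_{kk'} |Û_{kk'}|² [|Δ_k|²/E_k + |Δ_{k'}|²/E_{k'} - |Δ_k + Δ_{k'}|²/(E_k + E_{k'})]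
 ≥ (m/4) Σ_{kk'} |Û_{kk'}|² |Δ_k/E_k - Δ_{k'}/E_{k'}|² = (m/4) ‖[F, diag u]‖²_HS`.
No definition is introduced.
-/

noncomputable section

namespace Summit.HubbardSuperconductivity.HubbardSuperconductivity.Theorems

namespace BirBdG

open Matrix Finset Literature.Probability.LatticeModels
open scoped ComplexConjugate ComplexOrder

variable {L : ℕ} [NeZero L]

/-- Diagonal matrices with real positive entries, cast to `ℂ`, are positive definite. [folklore] -/
theorem lyap_posDef_diagonal {m : Type*} [Fintype m] [DecidableEq m] (E : m → ℝ) (hE : ∀ k, 0 < E k) :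
    (Matrix.diagonal (fun k => (E k : ℂ))).PosDef := by
  refine PosDef.of_dotProduct_mulVec_pos ?_ ?_
  · rw [Matrix.isHermitian_diagonal_iff]
    intro i
    exact Complex.conj_ofReal _
  · intro x hx
    obtain ⟨i, hi⟩ : ∃ i, x i ≠ 0 := by
      by_contra h
      push Not at h
      exact hx (funext h)
    have hexp : star x ⬝ᵥ (Matrix.diagonal (fun k => (E k : ℂ))) *ᵥ x =
        ∑ j, star (x j) * ((E j : ℂ) * x j) := by
      simp only [dotProduct, Matrix.mulVec_diagonal, Pi.star_apply]
    rw [hexp]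
    have hterm : ∀ j, star (x j) * ((E j : ℂ) * x j) = (((E j) * ‖x j‖ ^ 2 : ℝ) : ℂ) := by
      intro j
      rw [show star (x j) * ((E j : ℂ) * x j) = (E j : ℂ) * (conj (x j) * x j) by
        rw [Complex.star_def]; ring, Complex.conj_mul']
      push_cast
      ring
    simp_rw [hterm]
    rw [← Complex.ofReal_sum]
    refine Complex.zero_lt_real.2 (Finset.sum_pos' (fun j _ => mul_nonneg (hE j).le (sq_nonneg _))
      ⟨i, Finset.mem_univ _, ?_⟩)
    exact mul_pos (hE i) (pow_pos (norm_pos_iff.2 hi) 2)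

/-- **The Lyapunov deficit bound on the torus, commutator form.** See the module docstring. [folklore] -/
theorem lyap_core {L : ℕ} [NeZero L] (μ Δ₁ Δ₂ m : ℝ) (hL : 3 ≤ L) (ξ E : TorusSite 2 L → ℝ) (Δ : TorusSite 2 L → ℂ) (hξ : ∀ k, ξ k = -2 * Real.cos (latticeMomentum L k 0) - 2 * Real.cos (latticeMomentum L k 1) - μ) (hΔ : ∀ k, Δ k = ((2 * Δ₁ * (Real.cos (latticeMomentum L k 0) - Real.cos (latticeMomentum L k 1)) : ℝ) : ℂ) - 4 * Complex.I * ((Δ₂ * Real.sin (latticeMomentum L k 0) * Real.sin (latticeMomentum L k 1) : ℝ) : ℂ)) (hE : ∀ k, E k = Real.sqrt (ξ k ^ 2 + ‖Δ k‖ ^ 2)) (hm : 0 < m) (hmE : ∀ k, m ≤ E k) : let nnx : Literature.Probability.LatticeModels.TorusSite 2 L → Literature.Probability.LatticeModels.TorusSite 2 L → Prop := fun x y => y = x + ![1, 0] ∨ y = x + ![-1, 0]; let nny : Literature.Probability.LatticeModels.TorusSite 2 L → Literature.Probability.LatticeModels.TorusSite 2 L → Prop := fun x y => y = x + ![0, 1]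 ∨ y = x + ![0, -1]; let dg1 : Literature.Probability.LatticeModels.TorusSite 2 L → Literature.Probability.LatticeModels.TorusSite 2 L → Prop := fun x y => y = x + ![1, 1] ∨ y = x + ![-1, -1]; let dg2 : Literature.Probability.LatticeModels.TorusSite 2 L → Literature.Probability.LatticeModels.TorusSite 2 L → Prop := fun x y => y = x + ![1, -1] ∨ y = x + ![-1, 1]; let h : Matrix (Literature.Probability.LatticeModels.TorusSite 2 L) (Literature.Probability.LatticeModels.TorusSite 2 L) ℂ := fun x y => -(if nnx x y ∨ nny x y then (1 : ℂ) else 0) - (if x = y then (μ : ℂ) else 0); let D : (Literature.Probability.LatticeModels.TorusSite 2 L → ℝ) → Matrix (Literature.Probability.LatticeModels.TorusSite 2 L) (Literature.Probability.LatticeModels.TorusSite 2 L) ℂ := fun θ x y => ((Δ₁ : ℂ) * ((if nnx x y then (1 : ℂ) else 0) - (if nny x y then (1 : ℂ) else 0)) + Complex.I * (Δ₂ : ℂ) * ((if dg1 x y then (1 : ℂ) else 0) - (if dg2 x y then (1 : ℂ) else 0))) * (Complex.exp (Complex.I * (θ x : ℂ)) + Complex.exp (Complex.I * (θ y : ℂ)))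 / 2; let Hb : (Literature.Probability.LatticeModels.TorusSite 2 L → ℝ) → Matrix (Literature.Probability.LatticeModels.TorusSite 2 L ⊕ Literature.Probability.LatticeModels.TorusSite 2 L) (Literature.Probability.LatticeModels.TorusSite 2 L ⊕ Literature.Probability.LatticeModels.TorusSite 2 L) ℂ := fun θ => Matrix.fromBlocks h (D θ) (Matrix.conjTranspose (D θ)) (-h); ∀ θ : Literature.Probability.LatticeModels.TorusSite 2 L → ℝ, ∀ (hθ : (Hb θ).IsHermitian) (h0 : (Hb (fun _ => 0)).IsHermitian), m / 4 * ∑ x : TorusSite 2 L, ∑ y : TorusSite 2 L, ‖(((L ^ 2 : ℕ) : ℂ)⁻¹ • ((Matrix.of fun k x : TorusSite 2 L => conj (torusChar k x))ᴴ * Matrix.diagonal (fun k => Δ k / (E k : ℂ)) * Matrix.of (fun k x : TorusSite 2 L => conj (torusChar k x)))) x y‖ ^ 2 * ‖Complex.exp (Complex.I * (θ y : ℂ)) - Complex.exp (Complex.I * (θ x : ℂ))‖ ^ 2 ≤ ∑ i, |h0.eigenvalues i| - ∑ i, |hθ.eigenvalues i| := by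
  intro nnx nny dg1 dg2 h D Hb θ hθ h0
  -- the scaled plane-wave unitary `W` and `N = L²`
  have hN : (L ^ 2 : ℕ) ≠ 0 := pow_ne_zero 2 (NeZero.ne L)
  have h1 := planeWave_conjTranspose_mul_self (d := 2) (L := L)
  have h2 := planeWave_mul_conjTranspose_self (d := 2) (L := L)
  set W : Matrix (TorusSite 2 L) (TorusSite 2 L) ℂ :=
    Matrix.of (fun k x : TorusSite 2 L => conj (torusChar k x)) with hW
  -- stencils and the texture
  set a : TorusSite 2 L → ℂ := fun r : TorusSite 2 L =>
    -(if ((r = -![1, 0] ∨ r = -![-1, 0]) ∨ (r = -![0, 1] ∨ r = -![0, -1])) then (1 : ℂ) else 0) -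
      (if r = 0 then (μ : ℂ) else 0) with ha
  set dv : TorusSite 2 L → ℂ := fun r : TorusSite 2 L =>
    (Δ₁ : ℂ) * ((if (r = -![1, 0] ∨ r = -![-1, 0]) then (1 : ℂ) else 0) -
      (if (r = -![0, 1] ∨ r = -![0, -1]) then (1 : ℂ) else 0)) +
    Complex.I * (Δ₂ : ℂ) * ((if (r = -![1, 1] ∨ r = -![-1, -1]) then (1 : ℂ) else 0) -
      (if (r = -![1, -1] ∨ r = -![-1, 1]) then (1 : ℂ) else 0)) with hdv
  set u : TorusSite 2 L → ℂ := fun x => Complex.exp (Complex.I * (θ x : ℂ)) with hu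
  -- positivity of the dispersion
  have hEpos : ∀ k, 0 < E k := fun k => lt_of_lt_of_le hm (hmE k)
  have hEsq : ∀ k, E k ^ 2 = ξ k ^ 2 + ‖Δ k‖ ^ 2 := fun k => by
    rw [hE, Real.sq_sqrt (by positivity)]
  have hEsqC : ∀ k, (E k : ℂ) * (E k : ℂ) = (ξ k : ℂ) * (ξ k : ℂ) + Δ k * conj (Δ k) := fun k => by
    rw [Complex.mul_conj', ← sq, ← sq]
    exact_mod_cast hEsq k
  -- symbols
  have hFa : torusFourier a = fun k => (ξ k : ℂ) := by
    funext k
    rw [ha, torusFourier_hopVec hL μ k, hξ]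
  have hFd : torusFourier dv = Δ := by
    funext k
    rw [hdv, torusFourier_pairVec hL Δ₁ Δ₂ k, hΔ]
  -- the crux's matrices in structured form
  have hh : h = Matrix.circulant a := hopping_eq_circulant μ
  have hDθ : D θ = (1 / 2 : ℂ) • (Matrix.diagonal u * Matrix.circulant dv +
      Matrix.circulant dv * Matrix.diagonal u) := pairing_eq_anticommutator Δ₁ Δ₂ θ
  have hD0 : D (fun _ => 0) = Matrix.circulant dv := by
    have key := pairing_eq_anticommutator (L := L) Δ₁ Δ₂ (fun _ => (0 : ℝ))
    rw [← hdv] at key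
    change D (fun _ => 0) = _ at key
    rw [key]
    have hu0 : (Matrix.diagonal fun _ : TorusSite 2 L => Complex.exp (Complex.I * ((0 : ℝ) : ℂ))) = 1 := by
      rw [Complex.ofReal_zero, mul_zero, Complex.exp_zero]; exact Matrix.diagonal_one
    rw [hu0, Matrix.one_mul, Matrix.mul_one, ← two_smul ℂ (Matrix.circulant dv), smul_smul,
      show (1 / 2 : ℂ) * 2 = 1 by norm_num, one_smul]
  -- plane-wave (hat) forms
  have hath : ((L ^ 2 : ℕ) : ℂ)⁻¹ • (W * h * Wᴴ) = Matrix.diagonal (fun k => (ξ k : ℂ)) := by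
    rw [hh, hW, hat_circulant, hFa]
  have hatC : ((L ^ 2 : ℕ) : ℂ)⁻¹ • (W * D (fun _ => 0) * Wᴴ) = Matrix.diagonal Δ := by
    rw [hD0, hW, hat_circulant, hFd]
  have hatCh : ((L ^ 2 : ℕ) : ℂ)⁻¹ • (W * (D (fun _ => 0))ᴴ * Wᴴ) = (Matrix.diagonal Δ)ᴴ := by
    rw [hat_conjTranspose, hatC]
  set Ep : Matrix (TorusSite 2 L) (TorusSite 2 L) ℂ :=
    ((L ^ 2 : ℕ) : ℂ)⁻¹ • (Wᴴ * Matrix.diagonal (fun k => (E k : ℂ)) * W) with hEp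
  have hatE : ((L ^ 2 : ℕ) : ℂ)⁻¹ • (W * Ep * Wᴴ) = Matrix.diagonal (fun k => (E k : ℂ)) :=
    hat_unhat hN h2 _
  have hEpd : Ep.PosDef := posDef_unhat hN h1 (lyap_posDef_diagonal E hEpos)
  -- the hypotheses of the abstract deficit bound: identities of diagonal matrices
  have hdiagC : (Matrix.diagonal Δ)ᴴ = Matrix.diagonal (star Δ) := Matrix.diagonal_conjTranspose Δ
  have hEh : Ep * h = h * Ep := by
    apply hat_injective hN h1
    rw [← hat_mul hN h1, ← hat_mul hN h1, hatE, hath, Matrix.diagonal_mul_diagonal,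
      Matrix.diagonal_mul_diagonal]
    congr 1
    funext k
    ring
  have hEC : Ep * D (fun _ => 0) = D (fun _ => 0) * Ep := by
    apply hat_injective hN h1
    rw [← hat_mul hN h1, ← hat_mul hN h1, hatE, hatC, Matrix.diagonal_mul_diagonal,
      Matrix.diagonal_mul_diagonal]
    congr 1
    funext k
    ring
  have hhC : h * D (fun _ => 0) = D (fun _ => 0) * h := by
    apply hat_injective hN h1
    rw [← hat_mul hN h1, ← hat_mul hN h1, hath, hatC, Matrix.diagonal_mul_diagonal,
      Matrix.diagonal_mul_diagonal]
    congr 1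
    funext k
    ring
  have hCC : D (fun _ => 0) * (D (fun _ => 0))ᴴ = (D (fun _ => 0))ᴴ * D (fun _ => 0) := by
    apply hat_injective hN h1
    rw [← hat_mul hN h1, ← hat_mul hN h1, hatC, hatCh, hdiagC, Matrix.diagonal_mul_diagonal,
      Matrix.diagonal_mul_diagonal]
    congr 1
    funext k
    ring
  have hsq : Ep * Ep = h * h + D (fun _ => 0) * (D (fun _ => 0))ᴴ := by
    apply hat_injective hN h1
    rw [← hat_mul hN h1, hat_add, ← hat_mul hN h1, ← hat_mul hN h1, hatE, hath, hatC, hatCh, hdiagC,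
      Matrix.diagonal_mul_diagonal, Matrix.diagonal_mul_diagonal, Matrix.diagonal_mul_diagonal,
      Matrix.diagonal_add]
    congr 1
    funext k
    rw [hEsqC k]
    rfl
  have hhH : h.IsHermitian := (Matrix.isHermitian_fromBlocks_iff.1 h0).1
  -- the optimal `Φ` and the abstract bound
  set Dh : Matrix (TorusSite 2 L) (TorusSite 2 L) ℂ := ((L ^ 2 : ℕ) : ℂ)⁻¹ • (W * D θ * Wᴴ) with hDhdef
  have hΦ := fun α => lyap_admissible hN h1 h2 E hEpos (D θ) α
  have hdef := lyap_deficit h (D (fun _ => 0)) (D θ) Ep hhH hEpd hEh hEC hhC hCC hsq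
    (∑ k, ∑ k', ‖Dh k k'‖ ^ 2 / (E k + E k')) hΦ h0 hθ
  -- the inverse of `Ep` and the reference term `Re Tr (Ep⁻¹ Cᴴ C) = Σ_k |Δ_k|²/E_k`
  set Ei : Matrix (TorusSite 2 L) (TorusSite 2 L) ℂ :=
    ((L ^ 2 : ℕ) : ℂ)⁻¹ • (Wᴴ * Matrix.diagonal (fun k => ((E k : ℂ))⁻¹) * W) with hEi
  have hatEi : ((L ^ 2 : ℕ) : ℂ)⁻¹ • (W * Ei * Wᴴ) = Matrix.diagonal (fun k => ((E k : ℂ))⁻¹) :=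
    hat_unhat hN h2 _
  have hEinv : Ep⁻¹ = Ei := by
    apply Matrix.inv_eq_right_inv
    apply hat_injective hN h1
    rw [← hat_mul hN h1, hatE, hatEi, Matrix.diagonal_mul_diagonal, hat_one hN h2, ← Matrix.diagonal_one]
    congr 1
    funext k
    exact mul_inv_cancel₀ (by exact_mod_cast (hEpos k).ne')
  have href : (Ep⁻¹ * ((D (fun _ => 0))ᴴ * D (fun _ => 0))).trace.re = ∑ k, ‖Δ k‖ ^ 2 / E k := by
    rw [hEinv, ← trace_hat hN h1, ← hat_mul hN h1, ← hat_mul hN h1, hatEi, hatCh, hatC, hdiagC,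
      Matrix.diagonal_mul_diagonal, Matrix.diagonal_mul_diagonal, Matrix.trace_diagonal, Complex.re_sum]
    refine Finset.sum_congr rfl fun k _ => ?_
    rw [Pi.star_apply, Complex.star_def, show ((E k : ℂ))⁻¹ * (conj (Δ k) * Δ k) =
      (conj (Δ k) * Δ k) / (E k : ℂ) by rw [div_eq_mul_inv, mul_comm], Complex.conj_mul',
      ← Complex.ofReal_pow, ← Complex.ofReal_div, Complex.ofReal_re]
  rw [href] at hdef
  refine le_trans ?_ hdef
  -- the pairing block mode by mode: `D^_{kk'} = ½ Û_{kk'} (Δ_k + Δ_{k'})`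
  set Uh : Matrix (TorusSite 2 L) (TorusSite 2 L) ℂ :=
    ((L ^ 2 : ℕ) : ℂ)⁻¹ • (W * Matrix.diagonal u * Wᴴ) with hUhdef
  have hUh : ∀ k k', Uh k k' = ((L ^ 2 : ℕ) : ℂ)⁻¹ * ∑ x, u x * torusChar (k' - k) x := by
    intro k k'
    rw [hUhdef, hW, hat_diagonal_apply]
  have hDh : ∀ k k', Dh k k' = (1 / 2 : ℂ) * Uh k k' * (Δ k + Δ k') := by
    intro k k'
    rw [hDhdef, hDθ, hW, hat_pairing_apply u dv k k', hFd, hUh]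
  have hhalfn : ‖(1 / 2 : ℂ)‖ = 1 / 2 := by
    rw [norm_div, norm_one, Complex.norm_two]
  have hDhn : ∀ k k', ‖Dh k k'‖ ^ 2 = (1 / 4) * (‖Uh k k'‖ ^ 2 * ‖Δ k + Δ k'‖ ^ 2) := by
    intro k k'
    rw [hDh, norm_mul, norm_mul, mul_pow, mul_pow, hhalfn]
    ring
  -- `Û` is unitary: unit row and column sums
  have hunit : ∀ x, ‖u x‖ = 1 := by
    intro x
    rw [hu]
    dsimp only
    rw [mul_comm, Complex.norm_exp_ofReal_mul_I]
  have hUU : Matrix.diagonal u * (Matrix.diagonal u)ᴴ = 1 := by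
    rw [Matrix.diagonal_conjTranspose, Matrix.diagonal_mul_diagonal, ← Matrix.diagonal_one]
    congr 1
    funext x
    rw [Pi.star_apply, Complex.star_def, Complex.mul_conj', hunit, Complex.ofReal_one, one_pow]
  have hUU' : (Matrix.diagonal u)ᴴ * Matrix.diagonal u = 1 := by
    rw [Matrix.diagonal_conjTranspose, Matrix.diagonal_mul_diagonal, ← Matrix.diagonal_one]
    congr 1
    funext x
    rw [Pi.star_apply, Complex.star_def, Complex.conj_mul', hunit, Complex.ofReal_one, one_pow]
  have hrow : ∀ k, ∑ k', ‖Uh k k'‖ ^ 2 = 1 := by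
    refine lyap_row_normSq Uh ?_
    rw [hUhdef, ← hat_conjTranspose, hat_mul hN h1, hUU, hat_one hN h2]
  have hcol : ∀ k', ∑ k, ‖Uh k k'‖ ^ 2 = 1 := by
    refine lyap_col_normSq Uh ?_
    rw [hUhdef, ← hat_conjTranspose, hat_mul hN h1, hUU', hat_one hN h2]
  -- the Bergström sum
  have hsplit : ∑ k, ‖Δ k‖ ^ 2 / E k - 2 * ∑ k, ∑ k', ‖Dh k k'‖ ^ 2 / (E k + E k') =
      (1 / 2) * ∑ k, ∑ k', ‖Uh k k'‖ ^ 2 *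
        (‖Δ k‖ ^ 2 / E k + ‖Δ k'‖ ^ 2 / E k' - ‖Δ k + Δ k'‖ ^ 2 / (E k + E k')) := by
    have e1 : ∑ k, ‖Δ k‖ ^ 2 / E k = ∑ k, ∑ k', ‖Uh k k'‖ ^ 2 * (‖Δ k‖ ^ 2 / E k) := by
      refine Finset.sum_congr rfl fun k _ => ?_
      rw [← Finset.sum_mul, hrow, one_mul]
    have e2 : ∑ k, ‖Δ k‖ ^ 2 / E k = ∑ k, ∑ k', ‖Uh k k'‖ ^ 2 * (‖Δ k'‖ ^ 2 / E k') := by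
      rw [Finset.sum_comm]
      refine Finset.sum_congr rfl fun k' _ => ?_
      rw [← Finset.sum_mul, hcol, one_mul]
    have e3 : ∑ k, ∑ k', ‖Dh k k'‖ ^ 2 / (E k + E k') =
        ∑ k, ∑ k', ‖Uh k k'‖ ^ 2 * ((1 / 4) * (‖Δ k + Δ k'‖ ^ 2 / (E k + E k'))) := by
      refine Finset.sum_congr rfl fun k _ => Finset.sum_congr rfl fun k' _ => ?_
      rw [hDhn]
      ring
    have e4 : ∑ k, ‖Δ k‖ ^ 2 / E k = (1 / 2) * ∑ k, ∑ k', ‖Uh k k'‖ ^ 2 * (‖Δ k‖ ^ 2 / E k) +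
        (1 / 2) * ∑ k, ∑ k', ‖Uh k k'‖ ^ 2 * (‖Δ k'‖ ^ 2 / E k') := by
      rw [← e1, ← e2]; ring
    rw [e4, e3, Finset.mul_sum, Finset.mul_sum, Finset.mul_sum, Finset.mul_sum, ← Finset.sum_add_distrib,
      ← Finset.sum_sub_distrib]
    refine Finset.sum_congr rfl fun k _ => ?_
    rw [Finset.mul_sum, Finset.mul_sum, Finset.mul_sum, Finset.mul_sum, ← Finset.sum_add_distrib,
      ← Finset.sum_sub_distrib]
    refine Finset.sum_congr rfl fun k' _ => ?_
    ring
  have hberg : m / 4 * ∑ k, ∑ k', ‖Uh k k'‖ ^ 2 * ‖Δ k / (E k : ℂ) - Δ k' / (E k' : ℂ)‖ ^ 2 ≤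
      ∑ k, ‖Δ k‖ ^ 2 / E k - 2 * ∑ k, ∑ k', ‖Dh k k'‖ ^ 2 / (E k + E k') := by
    rw [hsplit, Finset.mul_sum, Finset.mul_sum]
    refine Finset.sum_le_sum fun k _ => ?_
    rw [Finset.mul_sum, Finset.mul_sum]
    refine Finset.sum_le_sum fun k' _ => ?_
    have hb := lyap_bergstrom hm (hmE k) (hmE k') (Δ k) (Δ k')
    have hw : 0 ≤ ‖Uh k k'‖ ^ 2 := sq_nonneg _
    calc m / 4 * (‖Uh k k'‖ ^ 2 * ‖Δ k / (E k : ℂ) - Δ k' / (E k' : ℂ)‖ ^ 2)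
        = (1 / 2) * (‖Uh k k'‖ ^ 2 * (m / 2 * ‖Δ k / (E k : ℂ) - Δ k' / (E k' : ℂ)‖ ^ 2)) := by ring
      _ ≤ (1 / 2) * (‖Uh k k'‖ ^ 2 *
          (‖Δ k‖ ^ 2 / E k + ‖Δ k'‖ ^ 2 / E k' - ‖Δ k + Δ k'‖ ^ 2 / (E k + E k'))) := by
          gcongr
  refine le_trans (le_of_eq ?_) hberg
  -- the commutator: `Σ |Û_{kk'}|² |F_k - F_{k'}|² = ‖[F, diag u]‖²_HS` in position space
  set Fp : Matrix (TorusSite 2 L) (TorusSite 2 L) ℂ :=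
    ((L ^ 2 : ℕ) : ℂ)⁻¹ • (Wᴴ * Matrix.diagonal (fun k => Δ k / (E k : ℂ)) * W) with hFp
  have hatF : ((L ^ 2 : ℕ) : ℂ)⁻¹ • (W * Fp * Wᴴ) = Matrix.diagonal (fun k => Δ k / (E k : ℂ)) :=
    hat_unhat hN h2 _
  have hcomm : ((L ^ 2 : ℕ) : ℂ)⁻¹ • (W * (Fp * Matrix.diagonal u - Matrix.diagonal u * Fp) * Wᴴ) =
      Matrix.diagonal (fun k => Δ k / (E k : ℂ)) * Uh - Uh * Matrix.diagonal (fun k => Δ k / (E k : ℂ)) := by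
    rw [Matrix.mul_sub, Matrix.sub_mul, smul_sub, ← hat_mul hN h1, ← hat_mul hN h1, hatF]
  have hHS := lyap_sum_normSq_hat hN h1 (Fp * Matrix.diagonal u - Matrix.diagonal u * Fp)
  rw [hcomm] at hHS
  have lhs_entry : ∀ k k', ‖(Matrix.diagonal (fun k => Δ k / (E k : ℂ)) * Uh -
      Uh * Matrix.diagonal (fun k => Δ k / (E k : ℂ))) k k'‖ ^ 2 =
      ‖Uh k k'‖ ^ 2 * ‖Δ k / (E k : ℂ) - Δ k' / (E k' : ℂ)‖ ^ 2 := by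
    intro k k'
    rw [Matrix.sub_apply, Matrix.diagonal_mul, Matrix.mul_diagonal,
      show Δ k / (E k : ℂ) * Uh k k' - Uh k k' * (Δ k' / (E k' : ℂ)) =
        Uh k k' * (Δ k / (E k : ℂ) - Δ k' / (E k' : ℂ)) by ring, norm_mul, mul_pow]
  have rhs_entry : ∀ x y, ‖(Fp * Matrix.diagonal u - Matrix.diagonal u * Fp) x y‖ ^ 2 =
      ‖Fp x y‖ ^ 2 * ‖u y - u x‖ ^ 2 := by
    intro x y
    rw [Matrix.sub_apply, Matrix.mul_diagonal, Matrix.diagonal_mul,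
      show Fp x y * u y - u x * Fp x y = Fp x y * (u y - u x) by ring, norm_mul, mul_pow]
  simp_rw [lhs_entry, rhs_entry] at hHS
  rw [hHS]

end BirBdG

end Summit.HubbardSuperconductivity.HubbardSuperconductivity.Theorems

end
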